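import Literature.Probability.LatticeModels.IsingEffectiveField
import Literature.Probability.LatticeModels.MessagerMiracleSole
import HarnessLib

/-!
# Peierls' flip estimate for the finite-volume Ising model with an arbitrary fixed boundary
# condition

Topic `Probability/LatticeModels` (any locally finite graph `G`, any fixed boundary condition
`η`, `β ≥ 0`, `h ≥ 0`). The one inequality behind every Peierls argument (Peierls 1936;
Griffiths 1964; Dobrushin 1965; Friedli–Velenik 2017, Lemma 3.36 and its proof, eqs.
(3.36)–(3.38): "flipping all the spins inside the contour"), in the form in which it is used for
systems with FROZEN spins of both signs (the internal-spin systems of van Enter–Fernández–Sokal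
1993, §4.3.1, where the flip cannot be combined with Griffiths' inequalities): for a finite set
`T ⊆ Λ` of sites and any finite set `N` of sites ("known `+` neighbours"),

`μ^η_{Λ;β,h}(σ ≡ -1 on T and σ ≡ +1 on N) ≤ exp(-2β (g - b))`,

where `g = ∑_{t ∈ T} #{z ∼ t : z ∉ T, z ∈ N}` counts the boundary bonds of `T` towards `N` and
`b = ∑_{t ∈ T} #{z ∼ t : z ∉ T, z ∉ N}` the other boundary bonds of `T` (`goodPairCount`,
`badPairCount`). Proof: the map flipping the spins of `T` (`flipOn`, `flipOnFin`) is injective on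
finite configurations and, on the event, multiplies the Boltzmann weight by
`exp(2β ∑_{t ∈ T} ∑_{z ∼ t, z ∉ T} σ_z + 2βh #T) ≥ exp(2β (g - b))`
(`isingHamiltonian_sub_isingHamiltonian_flipOn`, `isingWeight_le_exp_mul_isingWeight_flipOnFin`; the
flip `flipOn` itself is the tree's, from `MessagerMiracleSole`);
summing over the event and bounding the flipped sum by the partition function gives the claim
(`isingMeasure_real_minusOn_plusOn_le`). Nothing here is specific to `ℤ^d`; sites of `N` may lie
outside `Λ` (frozen boundary spins) or meet `T` (then the event is empty).

## References

* R. Peierls, *On Ising's model of ferromagnetism*, Proc. Camb. Phil. Soc. 32 (1936) 477.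
* S. Friedli, Y. Velenik, *Statistical Mechanics of Lattice Systems* (CUP 2017), §3.7.2,
  Lemma 3.36 [FriedliVelenik2017].
* A. C. D. van Enter, R. Fernández, A. D. Sokal, J. Stat. Phys. 72 (1993) 879, §4.3.1 and
  App. B.5.3 [VanenterFernandezSokal1993] (the intended application: contours of internal spins
  with the image spins frozen).
-/

noncomputable section

open MeasureTheory Finset

namespace Literature.Probability.LatticeModels

variable {V : Type*} [DecidableEq V] (G : SimpleGraph V) [G.LocallyFinite]

/-! ### Flipping the spins on a finite set `T` -/

/-- `σ_x` after the flip on `T` (the tree's `flipOn`, `MessagerMiracleSole`): `-σ_x` on `T`.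
[cite: FriedliVelenik2017, Lemma 3.36] -/
theorem spinAt_flipOn_of_mem {T : Finset V} (σ : SpinConfig V) {x : V} (hx : x ∈ T) :
    spinAt x (flipOn T σ) = -spinAt x σ := by
  rw [spinAt_flipOn, if_pos hx]

/-- `σ_x` after the flip on `T`: `σ_x` off `T`. [cite: FriedliVelenik2017, Lemma 3.36] -/
theorem spinAt_flipOn_of_notMem {T : Finset V} (σ : SpinConfig V) {x : V} (hx : x ∉ T) :
    spinAt x (flipOn T σ) = spinAt x σ := by
  rw [spinAt_flipOn, if_neg hx]

/-- The flip on `T` does not touch the spins off `T`. [cite: FriedliVelenik2017, Lemma 3.36] -/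
theorem flipOn_apply_of_notMem {T : Finset V} (σ : SpinConfig V) {x : V} (hx : x ∉ T) :
    flipOn T σ x = σ x := by
  simp [flipOn, hx]

/-- On `T` the flip reverses the spin. [cite: FriedliVelenik2017, Lemma 3.36] -/
theorem flipOn_apply_of_mem {T : Finset V} (σ : SpinConfig V) {x : V} (hx : x ∈ T) :
    flipOn T σ x = -σ x := by
  simp [flipOn, hx]

/-- The flip on `T` of a finite configuration `τ : Λ → ℤˣ`.
[cite: FriedliVelenik2017, Lemma 3.36] -/
def flipOnFin (Λ T : Finset V) (τ : Λ → ℤˣ) : Λ → ℤˣ :=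
  fun x => if (x : V) ∈ T then -τ x else τ x

/-- The flip on `T` is an involution of `Λ → ℤˣ`. [cite: FriedliVelenik2017, Lemma 3.36] -/
theorem flipOnFin_flipOnFin (Λ T : Finset V) (τ : Λ → ℤˣ) :
    flipOnFin Λ T (flipOnFin Λ T τ) = τ := by
  funext x
  by_cases hx : (x : V) ∈ T <;> simp [flipOnFin, hx]

/-- The flip on `T` is injective on finite configurations (the counting step of the Peierls
argument). [cite: FriedliVelenik2017, Lemma 3.36] -/
theorem flipOnFin_injective (Λ T : Finset V) : Function.Injective (flipOnFin Λ T) :=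
  Function.LeftInverse.injective (flipOnFin_flipOnFin Λ T)

/-- Gluing the flipped finite configuration is flipping the glued configuration (`T ⊆ Λ`, so
the boundary spins are untouched). [cite: FriedliVelenik2017, Lemma 3.36] -/
theorem glue_flipOnFin {Λ T : Finset V} (hT : T ⊆ Λ) (η : SpinConfig V) (τ : Λ → ℤˣ) :
    glue Λ (flipOnFin Λ T τ) (.fixed η) = flipOn T (glue Λ τ (.fixed η)) := by
  funext x
  by_cases hxT : x ∈ T
  · have hx : x ∈ Λ := hT hxT
    rw [flipOn_apply_of_mem _ hxT, glue_apply_of_mem Λ _ _ hx, glue_apply_of_mem Λ _ _ hx]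
    simp only [flipOnFin, hxT, if_true]
  · rw [flipOn_apply_of_notMem _ hxT]
    by_cases hx : x ∈ Λ
    · rw [glue_apply_of_mem Λ _ _ hx, glue_apply_of_mem Λ _ _ hx]
      simp only [flipOnFin, hxT, if_false]
    · rw [glue_apply_of_notMem Λ _ _ hx, glue_apply_of_notMem Λ _ _ hx]

/-! ### The energy released by the flip -/

/-- A bond with exactly one endpoint in `T` changes sign under the flip.
[cite: FriedliVelenik2017, Lemma 3.36] -/
theorem bondSpin_flipOn_mk_of_mem_of_notMem {T : Finset V} (σ : SpinConfig V) {x y : V}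
    (hx : x ∈ T) (hy : y ∉ T) : bondSpin (flipOn T σ) s(x, y) = -bondSpin σ s(x, y) := by
  rw [bondSpin_mk, bondSpin_mk, spinAt_flipOn_of_mem σ hx, spinAt_flipOn_of_notMem σ hy]
  ring

/-- A boundary bond of `T` changes sign under the flip on `T`.
[cite: FriedliVelenik2017, Lemma 3.36] -/
theorem bondSpin_flipOn_of_mem_edgeBoundary {T : Finset V} (σ : SpinConfig V) {e : Sym2 V}
    (he : e ∈ edgeBoundary G T) : bondSpin (flipOn T σ) e = -bondSpin σ e := by
  rw [mem_edgeBoundary_iff] at he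
  obtain ⟨-, ⟨x, hx, hxe⟩, ⟨y, hy, hye⟩⟩ := he
  have hxy : x ≠ y := fun h => hy (h ▸ hx)
  have hexy : e = s(x, y) := (Sym2.mem_and_mem_iff hxy).1 ⟨hxe, hye⟩
  subst hexy
  exact bondSpin_flipOn_mk_of_mem_of_notMem σ hx hy

/-- A bond of `G` touching `Λ` that is NOT a boundary bond of `T` (both endpoints in `T`, or none)
is unchanged by the flip on `T`. [cite: FriedliVelenik2017, Lemma 3.36] -/
theorem bondSpin_flipOn_of_not_mem_edgeBoundary {Λ T : Finset V} (σ : SpinConfig V) {e : Sym2 V}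
    (he : e ∈ edgesTouching G Λ) (hne : e ∉ edgeBoundary G T) :
    bondSpin (flipOn T σ) e = bondSpin σ e := by
  rw [mem_edgesTouching_iff] at he
  obtain ⟨heG, -⟩ := he
  induction e using Sym2.ind with
  | _ x y =>
    rw [bondSpin_mk, bondSpin_mk]
    by_cases hx : x ∈ T
    · by_cases hy : y ∈ T
      · rw [spinAt_flipOn_of_mem σ hx, spinAt_flipOn_of_mem σ hy]; ring
      · exact absurd (mem_edgeBoundary_iff.2 ⟨heG, ⟨x, hx, Sym2.mem_mk_left x y⟩,
          ⟨y, hy, Sym2.mem_mk_right x y⟩⟩) hne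
    · by_cases hy : y ∈ T
      · exact absurd (mem_edgeBoundary_iff.2 ⟨heG, ⟨y, hy, Sym2.mem_mk_right x y⟩,
          ⟨x, hx, Sym2.mem_mk_left x y⟩⟩) hne
      · rw [spinAt_flipOn_of_notMem σ hx, spinAt_flipOn_of_notMem σ hy]

/-- The boundary bonds of `T ⊆ Λ` are bonds touching `Λ`. [cite: FriedliVelenik2017, §3.1] -/
theorem edgeBoundary_subset_edgesTouching {Λ T : Finset V} (hT : T ⊆ Λ) :
    edgeBoundary G T ⊆ edgesTouching G Λ := by
  intro e he
  rw [mem_edgeBoundary_iff] at he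
  obtain ⟨heG, ⟨x, hx, hxe⟩, -⟩ := he
  exact mem_edgesTouching_iff.2 ⟨heG, x, hT hx, hxe⟩

/-- **The energy released by flipping `T ⊆ Λ`** (fixed boundary condition `η`, field `h`):
`H^η_{Λ;h}(σ) - H^η_{Λ;h}(σ^T) = -2 ∑_{e ∈ ∂ᵉT} σ_e - 2h ∑_{t ∈ T} σ_t` — only the boundary
bonds of `T` and the field on `T` change (Friedli–Velenik 2017, proof of Lemma 3.36,
eq. (3.37)). [cite: FriedliVelenik2017, Lemma 3.36] -/
theorem isingHamiltonian_sub_isingHamiltonian_flipOn {Λ T : Finset V} (hT : T ⊆ Λ) (h : ℝ)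
    (η σ : SpinConfig V) :
    isingHamiltonian G Λ h (.fixed η) σ - isingHamiltonian G Λ h (.fixed η) (flipOn T σ) =
      -2 * (∑ e ∈ edgeBoundary G T, bondSpin σ e) - 2 * h * ∑ t ∈ T, spinAt t σ := by
  have hbonds : ∑ e ∈ edgesTouching G Λ, bondSpin (flipOn T σ) e -
      ∑ e ∈ edgesTouching G Λ, bondSpin σ e = -2 * ∑ e ∈ edgeBoundary G T, bondSpin σ e := by
    rw [← Finset.sum_sub_distrib, Finset.mul_sum,
      ← Finset.sum_subset (edgeBoundary_subset_edgesTouching G hT)]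
    · refine Finset.sum_congr rfl fun e he => ?_
      rw [bondSpin_flipOn_of_mem_edgeBoundary G σ he]; ring
    · intro e he hne
      rw [bondSpin_flipOn_of_not_mem_edgeBoundary G σ he hne, sub_self]
  have hfield : ∑ x ∈ Λ, spinAt x (flipOn T σ) - ∑ x ∈ Λ, spinAt x σ =
      -2 * ∑ t ∈ T, spinAt t σ := by
    rw [← Finset.sum_sub_distrib, Finset.mul_sum, ← Finset.sum_subset hT]
    · refine Finset.sum_congr rfl fun t ht => ?_
      rw [spinAt_flipOn_of_mem σ ht]; ring
    · intro x _ hxT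
      rw [spinAt_flipOn_of_notMem σ hxT, sub_self]
  simp only [isingHamiltonian, interactionEdges_fixed]
  linear_combination hbonds + h * hfield

/-! ### The two counts of boundary bonds -/

/-- **The good boundary bonds of `T`**: pairs `(t, z)` with `t ∈ T`, `z ∼ t`, `z ∉ T`, `z ∈ N`
(bonds towards the sites known to carry a `+` spin).
[cite: FriedliVelenik2017, Lemma 3.36] -/
def goodPairCount (T N : Finset V) : ℕ :=
  ∑ t ∈ T, #((outNbrs G T t).filter fun z => z ∈ N)

/-- **The bad boundary bonds of `T`**: pairs `(t, z)` with `t ∈ T`, `z ∼ t`, `z ∉ T`, `z ∉ N`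
(bonds towards sites whose spin is not controlled; each costs at most `2β`).
[cite: FriedliVelenik2017, Lemma 3.36] -/
def badPairCount (T N : Finset V) : ℕ :=
  ∑ t ∈ T, #((outNbrs G T t).filter fun z => z ∉ N)

/-- On the event `σ ≡ +1 on N`, the boundary field felt by `t ∈ T` is at least
`#good(t) - #bad(t)`. [cite: FriedliVelenik2017, Lemma 3.36] -/
theorem sub_le_sum_outNbrs_spinAt {T N : Finset V} {σ : SpinConfig V}
    (hN : ∀ z ∈ N, σ z = 1) (t : V) :
    (#((outNbrs G T t).filter fun z => z ∈ N) : ℝ) - #((outNbrs G T t).filter fun z => z ∉ N) ≤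
      ∑ z ∈ outNbrs G T t, spinAt z σ := by
  rw [← Finset.sum_filter_add_sum_filter_not (outNbrs G T t) (fun z => z ∈ N)]
  have h1 : ∑ z ∈ (outNbrs G T t).filter (fun z => z ∈ N), spinAt z σ =
      #((outNbrs G T t).filter fun z => z ∈ N) := by
    rw [Finset.card_eq_sum_ones, Nat.cast_sum, Nat.cast_one]
    refine Finset.sum_congr rfl fun z hz => ?_
    have := hN z (Finset.mem_filter.1 hz).2
    simp [spinAt, this]
  have h2 : -(#((outNbrs G T t).filter fun z => z ∉ N) : ℝ) ≤
      ∑ z ∈ (outNbrs G T t).filter (fun z => z ∉ N), spinAt z σ := by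
    rw [Finset.card_eq_sum_ones, Nat.cast_sum, Nat.cast_one, ← Finset.sum_neg_distrib]
    refine Finset.sum_le_sum fun z _ => ?_
    rcases spinAt_eq_one_or_eq_neg_one z σ with hz | hz <;> norm_num [hz]
  linarith

/-- **The flip releases at least `2(g - b)` units of energy** on the event
`σ ≡ -1 on T`, `σ ≡ +1 on N` (with `h ≥ 0` the field term only helps):
`H(σ) - H(σ^T) ≥ 2 (g - b)`. [cite: FriedliVelenik2017, Lemma 3.36] -/
theorem two_mul_sub_le_isingHamiltonian_sub {Λ T N : Finset V} (hT : T ⊆ Λ) {h : ℝ} (hh : 0 ≤ h)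
    (η : SpinConfig V) {σ : SpinConfig V} (hTσ : ∀ t ∈ T, σ t = -1) (hN : ∀ z ∈ N, σ z = 1) :
    2 * ((goodPairCount G T N : ℝ) - badPairCount G T N) ≤
      isingHamiltonian G Λ h (.fixed η) σ - isingHamiltonian G Λ h (.fixed η) (flipOn T σ) := by
  rw [isingHamiltonian_sub_isingHamiltonian_flipOn G hT, sum_edgeBoundary_bondSpin]
  have hspin : ∀ t ∈ T, spinAt t σ = -1 := fun t ht => by simp [spinAt, hTσ t ht]
  have hbdry : ∑ y ∈ T, spinAt y σ * ∑ z ∈ outNbrs G T y, spinAt z σ =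
      -∑ y ∈ T, ∑ z ∈ outNbrs G T y, spinAt z σ := by
    rw [← Finset.sum_neg_distrib]
    exact Finset.sum_congr rfl fun t ht => by rw [hspin t ht]; ring
  have hfield : ∑ t ∈ T, spinAt t σ = -(#T : ℝ) := by
    rw [Finset.card_eq_sum_ones, Nat.cast_sum, Nat.cast_one, ← Finset.sum_neg_distrib]
    exact Finset.sum_congr rfl fun t ht => hspin t ht
  have hsum : (goodPairCount G T N : ℝ) - badPairCount G T N ≤
      ∑ y ∈ T, ∑ z ∈ outNbrs G T y, spinAt z σ := by
    simp only [goodPairCount, badPairCount, Nat.cast_sum, ← Finset.sum_sub_distrib]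
    exact Finset.sum_le_sum fun t _ => sub_le_sum_outNbrs_spinAt G hN t
  rw [hbdry, hfield]
  have hcard : (0 : ℝ) ≤ #T := Nat.cast_nonneg _
  nlinarith

/-- **The weight of a configuration of the event is at most `exp(-2β(g - b))` times the weight
of its flip** (`β ≥ 0`, `h ≥ 0`). [cite: FriedliVelenik2017, Lemma 3.36, eq. (3.37)] -/
theorem isingWeight_le_exp_mul_isingWeight_flipOnFin {Λ T N : Finset V} (hT : T ⊆ Λ) {β h : ℝ}
    (hβ : 0 ≤ β) (hh : 0 ≤ h) (η : SpinConfig V) {τ : Λ → ℤˣ}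
    (hTτ : ∀ t ∈ T, glue Λ τ (.fixed η) t = -1) (hN : ∀ z ∈ N, glue Λ τ (.fixed η) z = 1) :
    isingWeight G Λ β h (.fixed η) τ ≤
      Real.exp (-(2 * β * ((goodPairCount G T N : ℝ) - badPairCount G T N))) *
        isingWeight G Λ β h (.fixed η) (flipOnFin Λ T τ) := by
  simp only [isingWeight]
  rw [glue_flipOnFin hT, ← Real.exp_add]
  refine Real.exp_le_exp.2 ?_
  have key := two_mul_sub_le_isingHamiltonian_sub G hT hh η hTτ hN
  have := mul_le_mul_of_nonneg_left key hβ
  nlinarith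

/-! ### The estimate -/

omit [DecidableEq V] [G.LocallyFinite] in
/-- The event "`σ ≡ -1` on `T` and `σ ≡ +1` on `N`" is measurable (a finite intersection of
one-site cylinders). [cite: FriedliVelenik2017, §6.2] -/
theorem measurableSet_minusOn_plusOn (T N : Finset V) :
    MeasurableSet {σ : SpinConfig V | (∀ t ∈ T, σ t = -1) ∧ ∀ z ∈ N, σ z = 1} := by
  have h1 : ∀ (x : V) (u : ℤˣ),
      MeasurableSet ((fun σ : SpinConfig V => σ x) ⁻¹' ({u} : Set ℤˣ)) := fun x u =>
    measurable_pi_apply x (measurableSet_singleton u)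
  have heq : {σ : SpinConfig V | (∀ t ∈ T, σ t = -1) ∧ ∀ z ∈ N, σ z = 1} =
      (⋂ t ∈ T, (fun σ : SpinConfig V => σ t) ⁻¹' ({-1} : Set ℤˣ)) ∩
        ⋂ z ∈ N, (fun σ : SpinConfig V => σ z) ⁻¹' ({1} : Set ℤˣ) := by
    ext σ
    simp only [Set.mem_setOf_eq, Set.mem_inter_iff, Set.mem_iInter, Set.mem_preimage,
      Set.mem_singleton_iff]
  rw [heq]
  exact (Finset.measurableSet_biInter _ fun t _ => h1 t _).inter
    (Finset.measurableSet_biInter _ fun z _ => h1 z _)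

/-- **Peierls' flip estimate** (Friedli–Velenik 2017, Lemma 3.36, for an arbitrary fixed boundary
condition and with the released energy counted bond by bond): for `β ≥ 0`, `h ≥ 0`, `T ⊆ Λ` and
any finite set of sites `N`,
`μ^η_{Λ;β,h}(σ ≡ -1 on T, σ ≡ +1 on N) ≤ exp(-2β (g - b))` with `g = goodPairCount G T N`
(boundary bonds of `T` towards `N`) and `b = badPairCount G T N` (its other boundary bonds).
Proof: on the event each weight is at most `exp(-2β(g-b))` times the weight of the flipped
configuration (`isingWeight_le_exp_mul_isingWeight_flipOnFin`), the flip is injective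
(`flipOnFin_injective`), and the total flipped weight is at most the partition function.
[cite: FriedliVelenik2017, Lemma 3.36] -/
theorem isingMeasure_real_minusOn_plusOn_le (Λ : Finset V) {β h : ℝ} (hβ : 0 ≤ β) (hh : 0 ≤ h)
    (η : SpinConfig V) {T : Finset V} (hT : T ⊆ Λ) (N : Finset V) :
    (isingMeasure G Λ β h (.fixed η)).real
        {σ | (∀ t ∈ T, σ t = -1) ∧ ∀ z ∈ N, σ z = 1} ≤
      Real.exp (-(2 * β * ((goodPairCount G T N : ℝ) - badPairCount G T N))) := by
  classical
  set E : Set (SpinConfig V) := {σ | (∀ t ∈ T, σ t = -1) ∧ ∀ z ∈ N, σ z = 1} with hEdef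
  set c : ℝ := Real.exp (-(2 * β * ((goodPairCount G T N : ℝ) - badPairCount G T N))) with hcdef
  have hE : MeasurableSet E := measurableSet_minusOn_plusOn T N
  have hZ := isingPartitionFunction_pos G Λ β h (.fixed η)
  have hwnn : ∀ τ : Λ → ℤˣ, 0 ≤ isingWeight G Λ β h (.fixed η) τ :=
    fun τ => (isingWeight_pos G Λ β h _ τ).le
  set S : Finset (Λ → ℤˣ) := Finset.univ.filter fun τ => glue Λ τ (.fixed η) ∈ E with hSdef
  have hsum_nonneg : 0 ≤ ∑ τ ∈ S, isingWeight G Λ β h (.fixed η) τ :=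
    Finset.sum_nonneg fun τ _ => hwnn τ
  rw [measureReal_def, isingMeasure_apply_of_measurableSet G Λ β h _ hE,
    ENNReal.toReal_ofReal (div_nonneg hsum_nonneg hZ.le), div_le_iff₀ hZ]
  -- each weight on the event is at most `c` times the weight of its flip
  have hstep : ∑ τ ∈ S, isingWeight G Λ β h (.fixed η) τ ≤
      c * ∑ τ ∈ S, isingWeight G Λ β h (.fixed η) (flipOnFin Λ T τ) := by
    rw [Finset.mul_sum]
    refine Finset.sum_le_sum fun τ hτ => ?_
    have hτE : glue Λ τ (.fixed η) ∈ E := (Finset.mem_filter.1 hτ).2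
    exact isingWeight_le_exp_mul_isingWeight_flipOnFin G hT hβ hh η hτE.1 hτE.2
  -- the flip is injective, so the flipped weights sum to at most `Z`
  have hinj : ∑ τ ∈ S, isingWeight G Λ β h (.fixed η) (flipOnFin Λ T τ) ≤
      isingPartitionFunction G Λ β h (.fixed η) := by
    rw [← Finset.sum_image (f := fun τ => isingWeight G Λ β h (.fixed η) τ)
      (fun τ _ τ' _ hττ' => flipOnFin_injective Λ T hττ')]
    exact Finset.sum_le_sum_of_subset_of_nonneg (Finset.subset_univ _) fun τ _ _ => hwnn τ
  have hc : 0 ≤ c := (Real.exp_pos _).le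
  calc ∑ τ ∈ S, isingWeight G Λ β h (.fixed η) τ
      ≤ c * ∑ τ ∈ S, isingWeight G Λ β h (.fixed η) (flipOnFin Λ T τ) := hstep
    _ ≤ c * isingPartitionFunction G Λ β h (.fixed η) := mul_le_mul_of_nonneg_left hinj hc

end Literature.Probability.LatticeModels

end
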